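import Summits.QuantumFields.YangMills.Theses.ThermalDescent

/-!
# ThermalDescent — glue of the PeriodDescent split (gen 1)

`HsTransfer → ShortCentring → SpectralBounds → PeriodDescent` (item stmt-QuantumFields-27310, decl `PeriodDescentGlue`,
route file rev 5, commit 2170c9be1a4e).  Apply the short-centred Hilbert–Schmidt transfer inequality at
`(S, T, T') = (2L+1, 2L+1, 2^k·(2L+1))`, rewrite both two-point functions with the centring identity (the squared
shift vanishes on the short side and is discarded on the long side), and chain the two eigenvalue bounds; the rest
is real algebra (`periodDescent_algebra_core`).  This is the registered skeleton's composition
(`Cruxes/NT/Lines/thermal_descent_period_birth.lean` @255844ca2b92) with the three stubs as hypotheses.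
-/

namespace Summit.QuantumFields.YangMills.Theorems

/-- The real-number core of the period descent: from `Zp·e' ≤ λ^m·Z1·e`, `e = q`, `e' = q' + sh` (`sh ≥ 0`),
`λ^(T+m) ≤ Zp` and `Z2 ≤ λ^T·Z1` conclude `Z2/Z1²·q' ≤ q`. -/
theorem periodDescent_algebra_core {Zp Z1 Z2 lam e e' q q' x sh : ℝ} {m T : ℕ} (hlam : 0 < lam)
    (hZ1 : 0 < Z1) (hZp : 0 < Zp) (h1 : Zp * e' ≤ lam ^ m * Z1 * e) (h2 : e = q + (x - x) ^ 2)
    (h3 : e' = q' + sh) (hsh : 0 ≤ sh) (hq' : 0 ≤ q') (h4 : lam ^ (T + m) ≤ Zp) (h5 : Z2 ≤ lam ^ T * Z1) :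
    Z2 / Z1 ^ 2 * q' ≤ q := by
  have hm : 0 < lam ^ m := pow_pos hlam m
  have he : e = q := by rw [h2, sub_self]; ring
  rw [he, h3] at h1
  have hA : Zp * q' ≤ lam ^ m * Z1 * q := by nlinarith [mul_nonneg hZp.le hsh]
  have hD : lam ^ T * q' ≤ Z1 * q := by
    have h' : lam ^ m * (lam ^ T * q') ≤ lam ^ m * (Z1 * q) := by
      calc lam ^ m * (lam ^ T * q') = lam ^ (T + m) * q' := by rw [pow_add]; ring
        _ ≤ Zp * q' := mul_le_mul_of_nonneg_right h4 hq'
        _ ≤ lam ^ m * Z1 * q := hA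
        _ = lam ^ m * (Z1 * q) := by ring
    exact le_of_mul_le_mul_left h' hm
  have hE : Z2 * q' ≤ q * Z1 ^ 2 := by
    calc Z2 * q' ≤ lam ^ T * Z1 * q' := mul_le_mul_of_nonneg_right h5 hq'
      _ = Z1 * (lam ^ T * q') := by ring
      _ ≤ Z1 * (Z1 * q) := mul_le_mul_of_nonneg_left hD hZ1.le
      _ = q * Z1 ^ 2 := by ring
  have hZ1sq : 0 < Z1 ^ 2 := by positivity
  rw [div_mul_eq_mul_div, div_le_iff₀ hZ1sq]
  exact hE

open Summit.QuantumFields.YangMills.Theses.ThermalDescent in -- route file rev 5 (commit 2170c9be1a4e)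
/-- The glue item of the PeriodDescent split. -/
theorem thermalDescent_periodDescentGlue :
    Summit.QuantumFields.YangMills.Theses.ThermalDescent.PeriodDescentGlue := by
  intro hH hC hS G _ _ _ _ hG r
  dsimp only
  intro β L k s v δ₁ δ₂ hβ hL hs hδ₁ hsupp hsz hq
  letI : MeasurableSpace G := borel G
  haveI : BorelSpace G := ⟨rfl⟩
  haveI : SecondCountableTopology G :=
    (r.continuous.isClosedEmbedding r.injective).isEmbedding.secondCountableTopology
  have hT2 : 2 ≤ 2 * L + 1 := by omega
  have hTT' : 2 * L + 1 ≤ 2 ^ k * (2 * L + 1) := Nat.le_mul_of_pos_left _ (Nat.two_pow_pos k)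
  have hslab : 2 * δ₂ + 2 * s ≤ s * ((2 * L + 1 : ℕ) : ℝ) := by
    push_cast
    nlinarith
  have h1 := hH G hG r β (2 * L + 1) (2 * L + 1) (2 ^ k * (2 * L + 1)) s v δ₁ δ₂ hβ hT2 hTT' hs hδ₁ hsupp hslab
  have h2 := hC G hG r β (2 * L + 1) (2 * L + 1) (2 * L + 1) s v
  have h3 := hC G hG r β (2 * L + 1) (2 * L + 1) (2 ^ k * (2 * L + 1)) s v
  obtain ⟨hlam, h4, h5⟩ := hS G hG r β (2 * L + 1) (2 * L + 1) (2 ^ k * (2 * L + 1)) hβ hT2 hTT'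
  have hZ1 := Literature.MathematicalPhysics.QuantumFieldTheory.wilsonFinTorusPartition_pos (ρ := r.ρ)
    r.continuous β (2 * L + 1) (2 * L + 1) (2 * L + 1) (2 * L + 1)
  have hZp := Literature.MathematicalPhysics.QuantumFieldTheory.wilsonFinTorusPartition_pos (ρ := r.ρ)
    r.continuous β (2 * L + 1) (2 * L + 1) (2 * L + 1) (2 ^ k * (2 * L + 1))
  have h4' : Literature.MathematicalPhysics.QuantumFieldTheory.transferSpectralRadius r.ρ β (2 * L + 1) ^
      (2 * L + 1 + (2 ^ k * (2 * L + 1) - (2 * L + 1))) ≤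
      Literature.MathematicalPhysics.QuantumFieldTheory.wilsonFinTorusPartition r.ρ β (2 * L + 1) (2 * L + 1)
        (2 * L + 1) (2 ^ k * (2 * L + 1)) := by
    rw [Nat.add_sub_of_le hTT']; exact h4
  exact periodDescent_algebra_core hlam hZ1 hZp h1 h2 h3 (sq_nonneg _) hq h4' h5

end Summit.QuantumFields.YangMills.Theorems
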